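import Mathlib
import Summits.Schanuel.Schanuel.Theses.RigidCore
import Summits.Schanuel.Schanuel.Theorems.RigidCoreSchanuelOnLogFreeCoreCalibrationR
import Literature.Barriers.Schanuel.AlgebraicIndependenceOfLogarithms

/-!
# Crux `RigidCore.SchanuelOnLogFreeCore` (R), line `sector-split`, stub C26: (R) ⟹ the `π`-tower `π, e^π, e^{e^π}, …` is algebraically independent

Support file for crux `stmt-Schanuel-0970`
(`Summit.Schanuel.Schanuel.Theses.RigidCore.SchanuelOnLogFreeCore`, "(R)": Schanuel's statement for
`ℚ`-linearly independent tuples from the log-free core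
`C_EA = logFreeCore = sInf {K ≤ ℂ | 2πi ∈ K, K exp-closed, K relatively algebraically closed}`),
registered stub `stub_piTower_of_crux` (calibration C26) of the line's skeleton (lead c12, wave 3).
It CALIBRATES the crux and credits nothing towards it.

* `stub_piTower_of_crux` (registered signature verbatim): **(R) ⟹ for every `n`, the numbers
  `π, e^π, e^{e^π}, …, exp^[n−1] π` are algebraically independent over `ℚ`**
  (`fun k : Fin n => Complex.exp^[k] π`).  So the crux contains the folklore conjectures
  "`e^{e^π}` is transcendental", "`π, e^π, e^{e^π}` are algebraically independent", … (predictions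
  of Schanuel's conjecture at `(iπ, π, e^π, …)`); unconditionally only the first two entries are
  settled — `e^π` is transcendental (Gel'fond 1929) and `π ⊥ e^π` (Nesterenko 1996) — and not even
  the irrationality of `e^{e^π}` is known.

PROOF (induction on `n`, sub-namespace `PiTower`).  The empty family is algebraically independent.
For the step, assume `π, e^π, …, exp^[n−1] π` algebraically independent and consider the core tuple
`x = (2πi, π, e^π, …, exp^[n−1] π) : Fin (n + 1) → C_EA` (`2πi ∈ C_EA`,
`π = 2πi/(2i) ∈ C_EA` and `C_EA` is `exp`-closed, `PiTower.iterate_exp_pi_mem_logFreeCore`).  It is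
`ℚ`-linearly independent (`PiTower.linearIndependent_coreTuple`): all entries but `2πi` are real,
so the imaginary part of a rational relation kills the coefficient of `2πi`, and the real tail is
`ℚ`-free because it is algebraically independent.  (R) at `x` gives
`n + 1 ≤ trdeg ℚ(x, eˣ) ≤ trdeg ℚ(π, e^π, …, exp^[n] π, i) = trdeg ℚ(π, e^π, …, exp^[n] π)`
(`e^{2πi} = 1`; `i` is algebraic, `trdeg_adjoin_union_eq_of_isAlgebraic`), hence the `n + 1` numbers
`π, …, exp^[n] π` are algebraically independent (`algebraicIndependent_of_le_trdeg_adjoin`) —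
`PiTower.step`, modelled on `CalibrationR.piLogTwo_of_schanuelOnLogFreeCore`.
Photogenic instances: `PiTower.pi_expPi_expExpPi_of_crux` ((R) ⟹ `π, e^π, e^{e^π}` algebraically
independent) and `PiTower.transcendental_expExpPi_of_crux` ((R) ⟹ `e^{e^π}` transcendental).

What is NOT claimed: neither (R) nor any entry of the tower beyond Nesterenko's `π ⊥ e^π` is proved;
this is an implication between open statements, kernel-checked.
Sources: J. Kirby, *Exponential algebraicity in exponential fields*, Bull. LMS 42 (2010),
arXiv:0810.4285, Prop. 7.2 (the log-free core) [Kirby2010]; the tower statement is folklore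
(Schanuel's conjecture at `(iπ, π, e^π, …)`); Yu. V. Nesterenko, *Modular functions and
transcendence questions*, Sb. Math. 187 (1996) for `π ⊥ e^π`; the field-theoretic glue
(`algebraicIndependent_of_le_trdeg_adjoin`, `trdeg_adjoin_union_eq_of_isAlgebraic`, `isAlgebraic_I`)
is the tree's (`Literature.Barriers.Schanuel.*`), and `logFreeCore` with its API is the tree's
(`…AclSubsetLogFreeCore.Negative.LogFreeCoreObjects`, `…CalibrationA/R`).
-/

noncomputable section

set_option linter.dupNamespace false

open Summit.Schanuel.Schanuel.Theses
open Summit.Schanuel.Schanuel.Theorems.AclSubsetLogFreeCore.Negative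

namespace Summit.Schanuel.Schanuel.Theorems.RigidCore

namespace PiTower

open Complex IntermediateField

/-- The iterated exponentials of `π` are real numbers:
`exp^[k] π = ((Real.exp^[k] π : ℝ) : ℂ)`. [folklore] -/
theorem iterate_exp_pi_eq_ofReal (k : ℕ) :
    Complex.exp^[k] (Real.pi : ℂ) = ((Real.exp^[k] Real.pi : ℝ) : ℂ) := by
  induction k with
  | zero => rfl
  | succ k ih =>
    rw [Function.iterate_succ_apply', Function.iterate_succ_apply', ih, Complex.ofReal_exp]

/-- The iterated exponentials of `π` have zero imaginary part. [folklore] -/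
theorem iterate_exp_pi_im (k : ℕ) : (Complex.exp^[k] (Real.pi : ℂ)).im = 0 := by
  rw [iterate_exp_pi_eq_ofReal, Complex.ofReal_im]

/-- Every entry `exp^[k] π` of the `π`-tower lies in the log-free core `C_EA` (`π ∈ C_EA` and
`C_EA` is `exp`-closed). [folklore] -/
theorem iterate_exp_pi_mem_logFreeCore (k : ℕ) :
    Complex.exp^[k] (Real.pi : ℂ) ∈ logFreeCore := by
  induction k with
  | zero => exact CalibrationR.pi_mem_logFreeCore
  | succ k ih =>
    rw [Function.iterate_succ_apply']
    exact logFreeCore_mem_coreFamily.2.1 _ ih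

/-! The core tuple to which (R) is applied in the induction step is
`x = (2πi, π, e^π, …, exp^[n−1] π) = Fin.cons (2πi) (fun k : Fin n => exp^[k] π) : Fin (n + 1) → ℂ`
(kept as a literal `Fin.cons`, with `Fin.cons_zero` / `Fin.cons_succ` as its interface). -/

/-- The core tuple `(2πi, π, e^π, …, exp^[n−1] π)` lies in the log-free core. [folklore] -/
theorem coreTuple_mem_logFreeCore (n : ℕ) (i : Fin (n + 1)) :
    (Fin.cons (2 * ↑Real.pi * Complex.I) (fun k : Fin n => Complex.exp^[(k : ℕ)] (Real.pi : ℂ)) :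
      Fin (n + 1) → ℂ) i ∈ logFreeCore := by
  refine Fin.cases ?_ (fun k => ?_) i
  · rw [Fin.cons_zero]; exact two_pi_I_mem_logFreeCore
  · rw [Fin.cons_succ]; exact iterate_exp_pi_mem_logFreeCore k

/-- The core tuple `(2πi, π, e^π, …, exp^[n−1] π)` is `ℚ`-linearly independent as soon as its real
tail `π, e^π, …, exp^[n−1] π` is algebraically independent: the imaginary part of a rational
relation isolates the coefficient of `2πi`, and the tail is `ℚ`-linearly independent (algebraic
independence implies linear independence). [folklore] -/
theorem linearIndependent_coreTuple (n : ℕ)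
    (ih : AlgebraicIndependent ℚ (fun k : Fin n => Complex.exp^[(k : ℕ)] (Real.pi : ℂ))) :
    LinearIndependent ℚ
      (Fin.cons (2 * ↑Real.pi * Complex.I) (fun k : Fin n => Complex.exp^[(k : ℕ)] (Real.pi : ℂ)) :
        Fin (n + 1) → ℂ) := by
  rw [Fintype.linearIndependent_iff]
  intro c hc
  rw [Fin.sum_univ_succ] at hc
  simp only [Fin.cons_zero, Fin.cons_succ] at hc
  have h0 : c 0 = 0 := by
    have him := congrArg Complex.im hc
    rw [Complex.add_im, Complex.im_sum] at him
    simp only [Complex.smul_im, iterate_exp_pi_im, smul_zero, Finset.sum_const_zero, add_zero,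
      Complex.zero_im] at him
    have h2pi : (2 * ↑Real.pi * Complex.I : ℂ).im = 2 * Real.pi := by simp
    rw [h2pi, Rat.smul_def] at him
    have hpi : (2 * Real.pi : ℝ) ≠ 0 := by positivity
    exact_mod_cast (mul_eq_zero.mp him).resolve_right hpi
  have hrest : ∀ k : Fin n, c k.succ = 0 := by
    rw [h0, zero_smul, zero_add] at hc
    exact Fintype.linearIndependent_iff.mp ih.linearIndependent (fun k => c k.succ) hc
  intro i
  exact Fin.cases h0 hrest i

/-- **Induction step.**  If `π, e^π, …, exp^[n−1] π` are algebraically independent, then (R) at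
the `ℚ`-linearly independent core tuple `x = (2πi, π, e^π, …, exp^[n−1] π)` gives
`n + 1 ≤ trdeg ℚ(x, eˣ) ≤ trdeg ℚ(π, e^π, …, exp^[n] π, i) = trdeg ℚ(π, e^π, …, exp^[n] π)`
(`e^{2πi} = 1`, `i` is algebraic), so the `n + 1` numbers `π, e^π, …, exp^[n] π` are algebraically
independent. [folklore] -/
theorem step (hR : RigidCore.SchanuelOnLogFreeCore) (n : ℕ)
    (ih : AlgebraicIndependent ℚ (fun k : Fin n => Complex.exp^[(k : ℕ)] (Real.pi : ℂ))) :
    AlgebraicIndependent ℚ (fun k : Fin (n + 1) => Complex.exp^[(k : ℕ)] (Real.pi : ℂ)) := by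
  -- adapted from `CalibrationR.piLogTwo_of_schanuelOnLogFreeCore` ((πi, log 2) ↦ (2πi, π-tower))
  have hR' := CalibrationR.schanuelOnLogFreeCore_iff.mp hR
  set v : Fin (n + 1) → ℂ := fun k => Complex.exp^[(k : ℕ)] (Real.pi : ℂ) with hv
  apply Literature.Barriers.Schanuel.algebraicIndependent_of_le_trdeg_adjoin v
  set x : Fin (n + 1) → ℂ :=
    Fin.cons (2 * ↑Real.pi * Complex.I) (fun k : Fin n => Complex.exp^[(k : ℕ)] (Real.pi : ℂ))
  have h1 := hR' (n + 1) x (coreTuple_mem_logFreeCore n) (linearIndependent_coreTuple n ih)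
  have hx0 : x 0 = 2 * ↑Real.pi * Complex.I := Fin.cons_zero _ _
  have hxs : ∀ k : Fin n, x k.succ = Complex.exp^[(k : ℕ)] (Real.pi : ℂ) := fun k =>
    Fin.cons_succ _ _ k
  have hv0 : v 0 = (Real.pi : ℂ) := rfl
  have hvs : ∀ k : Fin n, v k.succ = Complex.exp (Complex.exp^[(k : ℕ)] (Real.pi : ℂ)) :=
    fun k => by simp only [hv, Fin.val_succ, Function.iterate_succ_apply']
  have hvc : ∀ k : Fin n, v (Fin.castSucc k) = Complex.exp^[(k : ℕ)] (Real.pi : ℂ) :=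
    fun k => by simp only [hv, Fin.val_castSucc]
  have hpi_mem : (Real.pi : ℂ) ∈ adjoin ℚ (Set.range v) := hv0 ▸ subset_adjoin ℚ _ ⟨0, rfl⟩
  have hI : I ∈ adjoin ℚ (Set.range v ∪ {I}) := subset_adjoin ℚ _ (Or.inr rfl)
  have hmono : adjoin ℚ (Set.range v) ≤ adjoin ℚ (Set.range v ∪ {I}) :=
    adjoin.mono ℚ _ _ Set.subset_union_left
  have hle : adjoin ℚ (Set.range x ∪ Set.range (Complex.exp ∘ x)) ≤
      adjoin ℚ (Set.range v ∪ {I}) := by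
    rw [adjoin_le_iff]
    rintro w (⟨i, rfl⟩ | ⟨i, rfl⟩)
    · refine Fin.cases ?_ (fun k => ?_) i
      · rw [hx0]
        exact mul_mem (mul_mem (ofNat_mem _ 2) (hmono hpi_mem)) hI
      · rw [hxs k]
        exact hmono ((hvc k) ▸ subset_adjoin ℚ _ ⟨Fin.castSucc k, rfl⟩)
    · refine Fin.cases ?_ (fun k => ?_) i
      · rw [Function.comp_apply, hx0, Complex.exp_two_pi_mul_I]
        exact one_mem _
      · rw [Function.comp_apply, hxs k]
        exact hmono ((hvs k) ▸ subset_adjoin ℚ _ ⟨k.succ, rfl⟩)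
  have hunion : Algebra.trdeg ℚ (adjoin ℚ (Set.range v ∪ {I})) =
      Algebra.trdeg ℚ (adjoin ℚ (Set.range v)) :=
    Literature.Barriers.Schanuel.trdeg_adjoin_union_eq_of_isAlgebraic (K := ℚ) (Set.range v)
      ({I} : Set ℂ) (fun w hw => by
        rw [Set.mem_singleton_iff.mp hw]
        exact Literature.Barriers.Schanuel.isAlgebraic_I)
  exact (h1.trans (CalibrationA.trdeg_mono hle)).trans_eq hunion

/-- **(R) ⟹ the `π`-tower is algebraically independent**: for every `n`, the numbers
`π, e^π, e^{e^π}, …, exp^[n−1] π` are algebraically independent over `ℚ` (induction on `n` by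
`step`; the empty family starts it). [folklore] -/
theorem tower (hR : RigidCore.SchanuelOnLogFreeCore) :
    ∀ n : ℕ, AlgebraicIndependent ℚ (fun k : Fin n => Complex.exp^[(k : ℕ)] (Real.pi : ℂ))
  | 0 => algebraicIndependent_empty_type
  | n + 1 => step hR n (tower hR n)

/-! ### Photogenic instances -/

/-- **(R) ⟹ `π, e^π, e^{e^π}` are algebraically independent** (the tower at `n = 3`; the first two
entries are Nesterenko's theorem, the full statement is printed open). [folklore] -/
theorem pi_expPi_expExpPi_of_crux (hR : RigidCore.SchanuelOnLogFreeCore) :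
    AlgebraicIndependent ℚ
      ![(Real.pi : ℂ), Complex.exp (Real.pi : ℂ), Complex.exp (Complex.exp (Real.pi : ℂ))] := by
  have h := tower hR 3
  convert h using 1
  funext k
  fin_cases k <;> rfl

/-- **(R) ⟹ `e^{e^π}` is transcendental** (not even its irrationality is known). [folklore] -/
theorem transcendental_expExpPi_of_crux (hR : RigidCore.SchanuelOnLogFreeCore) :
    Transcendental ℚ (Complex.exp (Complex.exp (Real.pi : ℂ))) := by
  simpa using (pi_expPi_expExpPi_of_crux hR).transcendental 2

end PiTower

/-! ## The registered stub -/

/-- **Registered stub `stub_piTower_of_crux` (C26) of line `sector-split`** (signature verbatim):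
the crux (R) — Schanuel's statement for `ℚ`-linearly independent tuples from the log-free core
`C_EA = sInf {K ≤ ℂ | 2πi ∈ K, K exp-closed, K relatively algebraically closed}` — implies that for
every `n` the `π`-tower `π, e^π, e^{e^π}, …, exp^[n−1] π` is algebraically independent over `ℚ`
(induction on `n`: (R) at the `ℚ`-free core tuple `(2πi, π, e^π, …, exp^[n−1] π)`, then
`e^{2πi} = 1` and `i` algebraic; proof `PiTower.tower`).  Printed open beyond `π ⊥ e^π` (Nesterenko 1996); this
calibrates (R), it closes nothing. [folklore] -/
theorem stub_piTower_of_crux :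
    RigidCore.SchanuelOnLogFreeCore →
      ∀ n : ℕ, AlgebraicIndependent ℚ (fun k : Fin n => Complex.exp^[(k : ℕ)] (Real.pi : ℂ)) := by
  intro hR n
  exact PiTower.tower hR n

end Summit.Schanuel.Schanuel.Theorems.RigidCore

end
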